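import Summits.NavierStokesRegularity.NavierStokesRegularity.Theses.AxisymmetricExtremality
import Literature.Analysis.FluidPDE.LocalTypeI
import HarnessLib

/-!
# Seregin 2020, proof of Thm 2.1, the no-swirl endgame core: the energy class of the blow-up
# limit on time slices, and two a.e.-to-everywhere tools

Helper toward the stub `stub_seregin2020TypeII` of the crux `AxisymmetricKatoGlobal` (= the named
fact `Literature.Analysis.FluidPDE.Seregin2020_axisymmetricSingularPoint_typeII`, G. Seregin,
Anal. Math. Phys. 10 (2020) Paper 46 = arXiv:2006.04140, Thm 2.1), last paragraph of the
printed proof (arXiv p. 8): near the clean first singular point the velocity of the swirl-free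
blow-up limit is recovered from its (bounded) vorticity and its energy — "`u ∈ L_{2,∞}`" is part
of Albritton–Barker's class `IsSuitableWeakSolutionInBall` of the limit, an a.e.-in-time
statement about `w`, while the elliptic estimate is applied to the continuous representative `V`
slice by slice. This file supplies the measure-theoretic glue:

* `ae_restrict_slice_eq_of_ae_eq_prod` — `w = V` a.e. on `I × U` gives, for a.e. `t ∈ I`,
  `w t = V t` a.e. on `U` (Fubini);
* `exists_ae_lintegral_sq_le_of_inBall` — hence the slice energy bound of the class passes to
  `V`: `∫_U ‖V t‖² ≤ C` for a.e. `t ∈ I` (`I × U ⊆ Q(a)`);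
* `setIntegral_norm_le_of_lintegral_sq_le` — `∫_K ‖f‖ ≤ |K| + C` for `f` continuous on a
  compact `K` with `∫_K ‖f‖² ≤ C` (`|a| ≤ 1 + a²`);
* `forall_le_of_ae_restrict_le_of_continuousOn` — a continuous function on an open real set
  which is `≤ B` a.e. is `≤ B` everywhere (open sets of positive length).

## References

* G. Seregin, Anal. Math. Phys. 10 (2020), Paper 46 = arXiv:2006.04140, proof of Thm. 2.1, last
  paragraph (arXiv p. 8), with Def. 1.3 (the class `L_{2,∞}`). [Seregin2020]
* D. Albritton, T. Barker, Arch. Ration. Mech. Anal. 232 (2019), Def. 2.1. [AlbrittonBarker2019]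
-/

-- the problem directory repeats the summit name (D-0017); core's `dupNamespace` linter fires
set_option linter.dupNamespace false

noncomputable section

open MeasureTheory Set Function Filter Topology TopologicalSpace Metric
open scoped NNReal ENNReal

namespace Summit.NavierStokesRegularity.NavierStokesRegularity.Theorems.AxisymmetricKatoGlobal.EulerScaling

open Literature.Analysis.FluidPDE

/-! ### Slices of an a.e. equality on a product set -/

/-- **Fubini for an a.e. equality on a product set**: if `w = V` a.e. on `I × U`, then for a.e.
`t ∈ I`, `w t = V t` a.e. on `U`. [folklore] -/
theorem ae_restrict_slice_eq_of_ae_eq_prod {I : Set ℝ} {U : Set (EuclideanSpace ℝ (Fin 3))}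
    {w V : ℝ → EuclideanSpace ℝ (Fin 3) → EuclideanSpace ℝ (Fin 3)}
    (h : uncurry w =ᵐ[volume.restrict (I ×ˢ U)] uncurry V) :
    ∀ᵐ t ∂(volume.restrict I), ∀ᵐ y ∂(volume.restrict U), w t y = V t y := by
  have h' : ∀ᵐ q ∂((volume.restrict I).prod (volume.restrict U)), uncurry w q = uncurry V q := by
    rw [Measure.prod_restrict, ← Measure.volume_eq_prod]
    exact h
  exact Measure.ae_ae_of_ae_prod h'

/-- **The slice energy bound passes to the representative.** If `(w, π)` is in
Albritton–Barker's class on `Q(a) = Q((0,0), a)` (so `sup_t ∫_{B(0,a)} |w(t)|² ≤ C` for a.e.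
`t ∈ ]-a², 0[`), `I × U ⊆ Q(a)` and `w = V` a.e. on `I × U`, then `∫_U ‖V t‖² ≤ C` for a.e.
`t ∈ I`. [cite: AlbrittonBarker2019, Def. 2.1] -/
theorem exists_ae_lintegral_sq_le_of_inBall :
    ∀ (w V : ℝ → EuclideanSpace ℝ (Fin 3) → EuclideanSpace ℝ (Fin 3))
      (π : ℝ → EuclideanSpace ℝ (Fin 3) → ℝ) (a : ℝ) (I : Set ℝ) (U : Set (EuclideanSpace ℝ (Fin 3))),
      IsSuitableWeakSolutionInBall a 0 w π → I ⊆ Ioo (-a ^ 2) 0 →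
      U ⊆ ball (0 : EuclideanSpace ℝ (Fin 3)) a →
      uncurry w =ᵐ[volume.restrict (I ×ˢ U)] uncurry V →
      ∃ C : ℝ≥0, ∀ᵐ t ∂(volume.restrict I), ∫⁻ y in U, ‖V t y‖ₑ ^ 2 ≤ C := by
  intro w V π a I U hwb hI hU h
  obtain ⟨-, ⟨C, hC⟩, -, -⟩ := hwb
  refine ⟨C, ?_⟩
  have h1 := ae_restrict_slice_eq_of_ae_eq_prod h
  have hC' : ∀ᵐ t ∂(volume.restrict (Ioo (-a ^ 2) 0)),
      ∫⁻ x in ball (0 : EuclideanSpace ℝ (Fin 3)) a, ‖w t x‖ₑ ^ 2 ≤ C := by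
    simpa only [Prod.fst_zero, Prod.snd_zero, zero_sub] using hC
  filter_upwards [h1, ae_restrict_of_ae_restrict_of_subset hI hC'] with t ht htC
  calc ∫⁻ y in U, ‖V t y‖ₑ ^ 2 = ∫⁻ y in U, ‖w t y‖ₑ ^ 2 := by
        refine lintegral_congr_ae ?_
        filter_upwards [ht] with y hy
        rw [hy]
    _ ≤ ∫⁻ y in ball (0 : EuclideanSpace ℝ (Fin 3)) a, ‖w t y‖ₑ ^ 2 := lintegral_mono_set hU
    _ ≤ C := htC

/-! ### From the squared energy to the local `L¹` norm -/

/-- **`∫_K ‖f‖ ≤ |K| + C`** for `f` continuous on a compact `K` with `∫_K ‖f‖² ≤ C`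
(pointwise `|a| ≤ 1 + a²`). [folklore] -/
theorem setIntegral_norm_le_of_lintegral_sq_le
    {f : EuclideanSpace ℝ (Fin 3) → EuclideanSpace ℝ (Fin 3)} {K : Set (EuclideanSpace ℝ (Fin 3))}
    (hK : IsCompact K) (hf : ContinuousOn f K) {C : ℝ≥0} (hC : ∫⁻ y in K, ‖f y‖ₑ ^ 2 ≤ C) :
    ∫ y in K, ‖f y‖ ≤ (volume K).toReal + C := by
  have hfin : volume K < ∞ := hK.measure_lt_top
  have hi1 : IntegrableOn (fun y => ‖f y‖) K volume := hf.norm.integrableOn_compact hK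
  have hi2 : IntegrableOn (fun y => ‖f y‖ ^ 2) K volume := (hf.norm.pow 2).integrableOn_compact hK
  have hi0 : IntegrableOn (fun _ : EuclideanSpace ℝ (Fin 3) => (1 : ℝ)) K volume :=
    integrableOn_const hfin.ne
  have hpt : ∀ y, ‖f y‖ ≤ 1 + ‖f y‖ ^ 2 := fun y => by
    nlinarith [sq_nonneg (‖f y‖ - 1), norm_nonneg (f y)]
  -- `∫ ‖f‖² ≤ C`
  have hsq : ∫ y in K, ‖f y‖ ^ 2 ≤ C := by
    have h := ofReal_integral_eq_lintegral_ofReal hi2 (ae_of_all _ fun y => sq_nonneg ‖f y‖)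
    have h2 : ∫⁻ y in K, ENNReal.ofReal (‖f y‖ ^ 2) = ∫⁻ y in K, ‖f y‖ₑ ^ 2 :=
      lintegral_congr fun y => by rw [← ofReal_norm, ENNReal.ofReal_pow (norm_nonneg _)]
    have h3 : ENNReal.ofReal (∫ y in K, ‖f y‖ ^ 2) ≤ C := by rw [h, h2]; exact hC
    have h4 := (ENNReal.ofReal_le_iff_le_toReal ENNReal.coe_ne_top).1 h3
    simpa using h4
  calc ∫ y in K, ‖f y‖ ≤ ∫ y in K, (1 + ‖f y‖ ^ 2) :=
        setIntegral_mono hi1 (hi0.add hi2) fun y => hpt y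
    _ = (volume K).toReal + ∫ y in K, ‖f y‖ ^ 2 := by
        rw [integral_add hi0 hi2, setIntegral_const, smul_eq_mul, mul_one, Measure.real]
    _ ≤ (volume K).toReal + C := by linarith

/-! ### A.e. bounds of continuous functions on open real sets hold everywhere -/

/-- **A continuous function on an open set of `ℝ` which is `≤ B` almost everywhere is `≤ B`
everywhere** (the exceptional set `{g > B}` is open, hence empty if null). [folklore] -/
theorem forall_le_of_ae_restrict_le_of_continuousOn {I : Set ℝ} (hI : IsOpen I) {g : ℝ → ℝ}
    (hg : ContinuousOn g I) {B : ℝ} (h : ∀ᵐ t ∂(volume.restrict I), g t ≤ B) :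
    ∀ t ∈ I, g t ≤ B := by
  intro t₀ ht₀
  by_contra hgt
  rw [not_le] at hgt
  -- the open set `{t ∈ I | B < g t}` is nonempty and null
  have hUo : IsOpen (I ∩ g ⁻¹' Ioi B) := hg.isOpen_inter_preimage hI isOpen_Ioi
  have hUne : (I ∩ g ⁻¹' Ioi B).Nonempty := ⟨t₀, ht₀, hgt⟩
  have hpos : 0 < volume (I ∩ g ⁻¹' Ioi B) := hUo.measure_pos volume hUne
  have hnull : volume (I ∩ g ⁻¹' Ioi B) = 0 := by
    rw [ae_iff, Measure.restrict_apply' hI.measurableSet] at h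
    refine measure_mono_null (fun t ht => ?_) h
    exact ⟨by simpa using ht.2, ht.1⟩
  rw [hnull] at hpos
  exact lt_irrefl _ hpos

/-! ### Essential boundedness from a pointwise bound of a representative -/

/-- If `w = V` a.e. on a set `Q` and `‖V‖ ≤ B` at every point of `Q`, then `w ∈ L_∞(Q)`.
[folklore] -/
theorem eLpNorm_top_lt_top_of_repr_bound {Q : Set (ℝ × EuclideanSpace ℝ (Fin 3))}
    (hQ : MeasurableSet Q) {w V : ℝ → EuclideanSpace ℝ (Fin 3) → EuclideanSpace ℝ (Fin 3)}
    (hae : uncurry w =ᵐ[volume.restrict Q] uncurry V) {B : ℝ}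
    (hB : ∀ q ∈ Q, ‖V q.1 q.2‖ ≤ B) :
    eLpNorm (uncurry w) ∞ (volume.restrict Q) < ∞ := by
  have h1 : ∀ᵐ q ∂(volume.restrict Q), ‖uncurry w q‖ ≤ B := by
    filter_upwards [hae, ae_restrict_mem hQ] with q hq hqQ
    rw [hq]
    exact hB q hqQ
  rw [eLpNorm_exponent_top]
  exact eLpNormEssSup_lt_top_of_ae_bound h1

end Summit.NavierStokesRegularity.NavierStokesRegularity.Theorems.AxisymmetricKatoGlobal.EulerScaling

end
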